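import Summits.ABC.StewartYu.PadicG3ExitBPrep
import HarnessLib

/-!
# Cell abc-stewartyu, Gen-3 record (WP-M3.R): exit B of the record from scalar facts — record-agnostic

`Summits/ABC/StewartYu/RecordExitBGeneric.lean` — cell `abc-stewartyu`, route `PadicPrimesKummerThird`, cruxes
`Y07Odd` (stmt-ABC-19658) / `Y07Two` (stmt-ABC-19659); seat lp-1 (g2).  Theorems only.
`PadicG3ExitB` (p483231) re-done with the box scale `L`, the degree scale `ρ`, the range scale `T` (`2^{Ŝ−1}` in
v1) and the Siegel constant `c` (`Cbⁿ` in v1, `Cbⁿ/gⁿ` in v2) as free reals, from the facts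
`Dⱼ ≤ ρ/Vⱼ + 1`, `1 ≤ ρ < L/2^{n+23}`, `1 ≤ Vⱼ`, `(3/2)(n+1)L ≤ X·c·Ω·K`, `D₀ ≤ 8X·c·Ω·K`, `D₀ ≤ X·L/2`,
`c ≤ 87ⁿ`, `16(n+1)L ≤ (S₀+1)(n+2)⁴`, `2^{n+23} ≤ T`, `T·X < 2X_f+1`, `2^{n+22}K < T`:
`exitB_of` = hypothesis `hB` of `RecordAssembly.recordTwo_of_ineqs` / `recordOdd_of_ineqs`.
References: Yu. V. Nesterenko, LNM 1819 (2003), §5.2 Lemma 5.4, (5.17)–(5.18).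
-/

noncomputable section

open Finset Real Nat

namespace Summit.ABC.StewartYu

namespace RecordExitsNumeric

open PadicG3Par (numB1i numB1ii numB0i numB0ii)

/-- Case `ρ < V_{j*}` for SOME `j*`: `∏ⱼ Dⱼ ≤ (L/2^{n+21})^{n−1}` (generic). [cite: Nesterenko2003, §5.2 (5.18)] -/
theorem prod_D_le_of_lt_of {n : ℕ} {V : Fin n → ℝ} (hV1 : ∀ j, 1 ≤ V j) {D : Fin n → ℕ} {ρ L : ℝ}
    (hDρ : ∀ j, (D j : ℝ) ≤ ρ / V j + 1) (hρ1 : 1 ≤ ρ) (hρ : ρ < L / 2 ^ (n + 23)) (hL : 0 < L)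
    {j₀ : Fin n} (h : ρ < V j₀) :
    (∏ j, (D j : ℝ)) ≤ (L / 2 ^ (n + 21)) ^ (n - 1) := by
  classical
  have hVpos : ∀ j, 0 < V j := fun j => by linarith [hV1 j]
  -- every `D j ≤ 2ρ ≤ L/2^{n+21}`; and `D j₀ ≤ 1`
  have hDle : ∀ j, (D j : ℝ) ≤ L / 2 ^ (n + 21) := by
    intro j
    have h1 := hDρ j
    have h2 : ρ / V j ≤ ρ := div_le_self (by linarith) (hV1 j)
    have e : L / 2 ^ (n + 21) = 4 * (L / 2 ^ (n + 23)) := by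
      rw [show (2 : ℝ) ^ (n + 23) = 2 ^ (n + 21) * 4 by ring]; field_simp
    rw [e]; linarith
  have hD1 : (D j₀ : ℝ) ≤ 1 := by
    have h1 := hDρ j₀
    have h2 : ρ / V j₀ < 1 := (div_lt_one (hVpos j₀)).mpr h
    have h3 : (D j₀ : ℝ) < 2 := by linarith
    have h4 : D j₀ < 2 := by exact_mod_cast h3
    exact_mod_cast Nat.lt_succ_iff.mp h4
  have h41 : (1 : ℝ) ≤ L / 2 ^ (n + 21) := by
    have e : L / 2 ^ (n + 21) = 4 * (L / 2 ^ (n + 23)) := by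
      rw [show (2 : ℝ) ^ (n + 23) = 2 ^ (n + 21) * 4 by ring]; field_simp
    rw [e]; linarith
  rw [← Finset.mul_prod_erase univ (fun j => (D j : ℝ)) (mem_univ j₀)]
  have hcard : (univ.erase j₀).card = n - 1 := by
    rw [card_erase_of_mem (mem_univ _), Finset.card_univ, Fintype.card_fin]
  calc (D j₀ : ℝ) * ∏ j ∈ univ.erase j₀, (D j : ℝ) ≤ 1 * ∏ _j ∈ univ.erase j₀, L / 2 ^ (n + 21) := by
        apply mul_le_mul hD1 (prod_le_prod (fun j _ => by positivity) fun j _ => hDle j)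
          (prod_nonneg fun j _ => by positivity) zero_le_one
    _ = (L / 2 ^ (n + 21)) ^ (n - 1) := by rw [one_mul, prod_const, hcard]

/-- Case `Vⱼ ≤ ρ` for ALL `j`: `Ω · ∏ⱼ Dⱼ ≤ (L/2^{n+22})ⁿ` (generic, `Ω = ∏ V`). [cite: Nesterenko2003, §5.2 (5.18)] -/
theorem prod_mul_prod_D_le_of {n : ℕ} {V : Fin n → ℝ} (hV1 : ∀ j, 1 ≤ V j) {D : Fin n → ℕ} {ρ L : ℝ}
    (hDρ : ∀ j, (D j : ℝ) ≤ ρ / V j + 1) (hρ1 : 1 ≤ ρ) (hρ : ρ < L / 2 ^ (n + 23)) (hL : 0 < L)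
    (h : ∀ j, V j ≤ ρ) :
    (∏ j, V j) * ∏ j, (D j : ℝ) ≤ (L / 2 ^ (n + 22)) ^ n := by
  have hVpos : ∀ j, 0 < V j := fun j => by linarith [hV1 j]
  have hρ0 : 0 ≤ ρ := by linarith
  have hD2 : ∀ j, (D j : ℝ) ≤ 2 * ρ / V j := by
    intro j
    have h1 := hDρ j
    have h2 : 1 ≤ ρ / V j := by rw [le_div_iff₀ (hVpos j), one_mul]; exact h j
    calc (D j : ℝ) ≤ ρ / V j + 1 := h1
      _ ≤ ρ / V j + ρ / V j := by linarith
      _ = 2 * ρ / V j := by ring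
  have h1 : ∏ j, (D j : ℝ) ≤ ∏ j, (2 * ρ / V j) :=
    prod_le_prod (fun j _ => by positivity) fun j _ => hD2 j
  have hΩ : 0 < ∏ j, V j := prod_pos fun j _ => hVpos j
  have h2 : ∏ j, (2 * ρ / V j) = (2 * ρ) ^ n / ∏ j, V j := by
    rw [prod_div_distrib, prod_const, Finset.card_univ, Fintype.card_fin]
  have h3 : 2 * ρ ≤ L / 2 ^ (n + 22) := by
    have e : L / 2 ^ (n + 22) = 2 * (L / 2 ^ (n + 23)) := by
      rw [show (2 : ℝ) ^ (n + 23) = 2 ^ (n + 22) * 2 by ring]; field_simp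
    rw [e]; linarith
  calc (∏ j, V j) * ∏ j, (D j : ℝ) ≤ (∏ j, V j) * ((2 * ρ) ^ n / ∏ j, V j) := by
        rw [← h2]; exact mul_le_mul_of_nonneg_left h1 hΩ.le
    _ = (2 * ρ) ^ n := by field_simp
    _ ≤ (L / 2 ^ (n + 22)) ^ n := pow_le_pow_left₀ (by positivity) h3 n

/-- **Exit B, `d₀ = 1` (`G* = 𝔾ₐ`)**: `(n+1)!·(n−1)!·2ⁿ·∏ Dⱼ < (S₀+1)^{n−1}·(2X_fin+1)`.
[cite: Nesterenko2003, §5.2 Lemma 5.4] -/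
theorem exitB_one_of {n : ℕ} (hn : 1 ≤ n) {V : Fin n → ℝ} (hV1 : ∀ j, 1 ≤ V j)
    {D : Fin n → ℕ} {ρ L X K c T : ℝ} {S₀ Xf D₀ : ℕ}
    (hDρ : ∀ j, (D j : ℝ) ≤ ρ / V j + 1) (hρ1 : 1 ≤ ρ) (hρ : ρ < L / 2 ^ (n + 23)) (hL : 0 < L)
    (hX1 : 1 ≤ X) (hK1 : 1 ≤ K) (_hc0 : 0 ≤ c) (hc : c ≤ (87 : ℝ) ^ n)
    (h3L : (3 / 2 : ℝ) * (n + 1) * L ≤ X * (c * (∏ j, V j) * K))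
    (hD₀8 : (D₀ : ℝ) ≤ 8 * X * (c * (∏ j, V j) * K)) (_hD₀half : (D₀ : ℝ) ≤ X * L / 2)
    (hs : (16 : ℝ) * (n + 1) * L ≤ ((S₀ : ℝ) + 1) * ((n : ℝ) + 2) ^ 4)
    (h23 : (2 : ℝ) ^ (n + 23) ≤ T) (hxf : T * X < 2 * (Xf : ℝ) + 1) (hK : (2 : ℝ) ^ (n + 22) * K < T) :
    (n + 1)! * (n - 1)! * 2 ^ n * ∏ j, D j < (S₀ + 1) ^ (n - 1) * (2 * Xf + 1) := by
  obtain ⟨k, hk⟩ : ∃ k, n = k + 1 := ⟨n - 1, (Nat.sub_add_cancel hn).symm⟩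
  subst hk
  simp only [Nat.add_sub_cancel]
  -- real-number form
  have hs0 : (0 : ℝ) < (S₀ : ℝ) + 1 := by positivity
  set s : ℝ := (S₀ : ℝ) + 1 with hsdef
  set xf : ℝ := 2 * (Xf : ℝ) + 1 with hxfdef
  -- `16(k+2)L ≤ s (k+3)^4`
  have hs' : 16 * ((k : ℝ) + 2) * L ≤ s * ((k : ℝ) + 3) ^ 4 := by
    have := hs; push_cast at this; rw [hsdef]; nlinarith
  have hbase : 0 ≤ 16 * ((k : ℝ) + 2) * L := by positivity
  suffices hreal : (((k + 1 + 1)! : ℕ) : ℝ) * ((k ! : ℕ) : ℝ) * 2 ^ (k + 1) * ∏ j, (D j : ℝ) < s ^ k * xf by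
    rw [hsdef, hxfdef] at hreal
    exact_mod_cast hreal
  -- the largest height
  obtain ⟨j₀, -, hj₀⟩ := Finset.exists_max_image (univ : Finset (Fin (k + 1))) V ⟨0, mem_univ _⟩
  have hprod0 : 0 ≤ ∏ j, (D j : ℝ) := prod_nonneg fun j _ => by positivity
  by_cases hlt : ρ < V j₀
  · -- case (i): `D_{j₀} = 1`, `∏ D ≤ (L/2^{k+22})^k`
    have hprod := prod_D_le_of_lt_of hV1 hDρ hρ1 hρ hL hlt
    simp only [Nat.add_sub_cancel] at hprod
    have hnum : (((k + 2)! * k ! * 2 ^ (k + 1) * (k + 3) ^ (4 * k) : ℕ) : ℝ) ≤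
        (((16 * (k + 2)) ^ k * 2 ^ ((k + 22) * k) * 2 ^ (k + 24) : ℕ) : ℝ) := by
      exact_mod_cast numB1i k
    push_cast at hnum
    set Q : ℝ := (16 * ((k : ℝ) + 2)) ^ k * 2 ^ ((k + 22) * k) with hQ
    have hQ0 : 0 < Q := by positivity
    -- `(L/2^{k+22})^k · Q = (16(k+2)L)^k ≤ (s (k+3)^4)^k`
    have e1 : (L / 2 ^ (k + 1 + 21)) ^ k * Q = (16 * ((k : ℝ) + 2) * L) ^ k := by
      rw [hQ, show k + 1 + 21 = k + 22 by ring]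
      simp only [mul_pow, div_pow]
      rw [← pow_mul]
      field_simp
    have hpow : (16 * ((k : ℝ) + 2) * L) ^ k ≤ (s * ((k : ℝ) + 3) ^ 4) ^ k :=
      pow_le_pow_left₀ hbase hs' k
    have key : (((k + 1 + 1)! : ℕ) : ℝ) * ((k ! : ℕ) : ℝ) * 2 ^ (k + 1) * (∏ j, (D j : ℝ)) * Q ≤
        (2 ^ (k + 24) * s ^ k) * Q := by
      calc (((k + 1 + 1)! : ℕ) : ℝ) * ((k ! : ℕ) : ℝ) * 2 ^ (k + 1) * (∏ j, (D j : ℝ)) * Q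
          ≤ (((k + 1 + 1)! : ℕ) : ℝ) * ((k ! : ℕ) : ℝ) * 2 ^ (k + 1) * (L / 2 ^ (k + 1 + 21)) ^ k * Q := by
            gcongr
        _ = (((k + 1 + 1)! : ℕ) : ℝ) * ((k ! : ℕ) : ℝ) * 2 ^ (k + 1) * ((L / 2 ^ (k + 1 + 21)) ^ k * Q) := by
            ring
        _ ≤ (((k + 1 + 1)! : ℕ) : ℝ) * ((k ! : ℕ) : ℝ) * 2 ^ (k + 1) * (s * ((k : ℝ) + 3) ^ 4) ^ k := by
            rw [e1]; gcongr
        _ = ((((k + 2)! : ℕ) : ℝ) * ((k ! : ℕ) : ℝ) * 2 ^ (k + 1) * ((k : ℝ) + 3) ^ (4 * k)) * s ^ k := by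
            rw [mul_pow, ← pow_mul, show k + 1 + 1 = k + 2 by ring]; ring
        _ ≤ ((16 * ((k : ℝ) + 2)) ^ k * 2 ^ ((k + 22) * k) * 2 ^ (k + 24)) * s ^ k :=
            mul_le_mul_of_nonneg_right hnum (by positivity)
        _ = (2 ^ (k + 24) * s ^ k) * Q := by rw [hQ]; ring
    have hmain := le_of_mul_le_mul_right key hQ0
    -- `2^{k+24} s^k ≤ 2^{Ŝ-1} s^k ≤ 2^{Ŝ-1} X s^k < xf s^k`
    have h1 : (2 : ℝ) ^ (k + 24) ≤ T := by
      simpa [show k + 1 + 23 = k + 24 by ring] using h23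
    have hT0 : (0 : ℝ) ≤ T := le_trans (by positivity) h23
    have h2 : T ≤ T * X :=
      le_mul_of_one_le_right hT0 hX1
    have hsk : 0 < s ^ k := by positivity
    calc (((k + 1 + 1)! : ℕ) : ℝ) * ((k ! : ℕ) : ℝ) * 2 ^ (k + 1) * ∏ j, (D j : ℝ)
        ≤ 2 ^ (k + 24) * s ^ k := hmain
      _ ≤ T * X * s ^ k := by gcongr; exact h1.trans h2
      _ < xf * s ^ k := mul_lt_mul_of_pos_right hxf hsk
      _ = s ^ k * xf := mul_comm _ _
  · -- case (ii): all `A_j ≤ ρ`, `Ω ∏ D ≤ (L/2^{k+23})^{k+1}`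
    have hle : ∀ j, V j ≤ ρ := fun j =>
      (hj₀ j (mem_univ j)).trans (not_lt.mp hlt)
    have hprod := prod_mul_prod_D_le_of hV1 hDρ hρ1 hρ hL hle
    have hΩ : 0 < ∏ j, V j := prod_pos fun j _ => by linarith [hV1 j]
    have hnum : ((2 * ((k + 1)! * k ! * 2 ^ (k + 1) * (k + 3) ^ (4 * k) * 87 ^ (k + 1)) : ℕ) : ℝ) ≤
        ((3 * ((16 * (k + 2)) ^ k * 2 ^ ((k + 1) * (k + 23)) * 2 ^ (k + 23)) : ℕ) : ℝ) := by
      exact_mod_cast numB1ii k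
    push_cast at hnum
    have hCbpow : c ≤ (87 : ℝ) ^ (k + 1) := hc
    have h3L' := h3L
    push_cast at h3L'
    -- `3 (k+2) L ≤ 2 X (Cb^{k+1} Ω K)`
    have h3L' : 3 * ((k : ℝ) + 2) * L ≤ 2 * X * (c * (∏ j, V j) * K) := by
      nlinarith
    set Q : ℝ := (16 * ((k : ℝ) + 2)) ^ k * 2 ^ ((k + 1) * (k + 23)) * (3 * ((k : ℝ) + 2)) with hQ
    have hQ0 : 0 < Q := by positivity
    -- `(L/2^{k+23})^{k+1} · (16(k+2))^k 2^{(k+1)(k+23)} · 3(k+2) = (16(k+2)L)^k · 3(k+2) L`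
    have e1 : (L / 2 ^ (k + 1 + 22)) ^ (k + 1) * Q =
        (16 * ((k : ℝ) + 2) * L) ^ k * (3 * ((k : ℝ) + 2) * L) := by
      rw [hQ, show k + 1 + 22 = k + 23 by ring, mul_comm (k + 1) (k + 23)]
      simp only [mul_pow, div_pow]
      rw [← pow_mul]
      field_simp
      ring
    have hpow : (16 * ((k : ℝ) + 2) * L) ^ k ≤ (s * ((k : ℝ) + 3) ^ 4) ^ k :=
      pow_le_pow_left₀ hbase hs' k
    have hfac : (((k + 1 + 1)! : ℕ) : ℝ) = ((k : ℝ) + 2) * (((k + 1)! : ℕ) : ℝ) := by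
      rw [show k + 1 + 1 = (k + 1) + 1 by ring, Nat.factorial_succ]; push_cast; ring
    have key : (((k + 1 + 1)! : ℕ) : ℝ) * ((k ! : ℕ) : ℝ) * 2 ^ (k + 1) * (∏ j, (D j : ℝ)) *
          ((∏ j, V j) * Q) ≤ (2 ^ (k + 23) * K * X * s ^ k) * ((∏ j, V j) * Q) := by
      calc (((k + 1 + 1)! : ℕ) : ℝ) * ((k ! : ℕ) : ℝ) * 2 ^ (k + 1) * (∏ j, (D j : ℝ)) * ((∏ j, V j) * Q)
          = (((k + 1 + 1)! : ℕ) : ℝ) * ((k ! : ℕ) : ℝ) * 2 ^ (k + 1) * ((∏ j, V j) * ∏ j, (D j : ℝ)) * Q := by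
            ring
        _ ≤ (((k + 1 + 1)! : ℕ) : ℝ) * ((k ! : ℕ) : ℝ) * 2 ^ (k + 1) * (L / 2 ^ (k + 1 + 22)) ^ (k + 1) * Q := by
            gcongr
        _ = (((k + 1 + 1)! : ℕ) : ℝ) * ((k ! : ℕ) : ℝ) * 2 ^ (k + 1) *
              ((16 * ((k : ℝ) + 2) * L) ^ k * (3 * ((k : ℝ) + 2) * L)) := by rw [← e1]; ring
        _ ≤ (((k + 1 + 1)! : ℕ) : ℝ) * ((k ! : ℕ) : ℝ) * 2 ^ (k + 1) *
              ((s * ((k : ℝ) + 3) ^ 4) ^ k * (2 * X * (c * (∏ j, V j) * K))) := by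
            gcongr
        _ = ((k : ℝ) + 2) * (2 * ((((k + 1)! : ℕ) : ℝ) * ((k ! : ℕ) : ℝ) * 2 ^ (k + 1) *
              ((k : ℝ) + 3) ^ (4 * k) * c)) * (s ^ k * X * (∏ j, V j) * K) := by
            rw [hfac, mul_pow, ← pow_mul]; ring
        _ ≤ ((k : ℝ) + 2) * (2 * ((((k + 1)! : ℕ) : ℝ) * ((k ! : ℕ) : ℝ) * 2 ^ (k + 1) *
              ((k : ℝ) + 3) ^ (4 * k) * 87 ^ (k + 1))) * (s ^ k * X * (∏ j, V j) * K) := by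
            gcongr
        _ ≤ ((k : ℝ) + 2) * (3 * ((16 * ((k : ℝ) + 2)) ^ k * 2 ^ ((k + 1) * (k + 23)) * 2 ^ (k + 23))) *
              (s ^ k * X * (∏ j, V j) * K) := by
            gcongr
        _ = (2 ^ (k + 23) * K * X * s ^ k) * ((∏ j, V j) * Q) := by rw [hQ]; ring
    have hmain := le_of_mul_le_mul_right key (by positivity)
    have hK' : (2 : ℝ) ^ (k + 23) * K < T := by
      simpa [show k + 1 + 22 = k + 23 by ring] using hK
    have hsk : 0 < s ^ k := by positivity
    have hX0 : (0 : ℝ) < X := by linarith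
    calc (((k + 1 + 1)! : ℕ) : ℝ) * ((k ! : ℕ) : ℝ) * 2 ^ (k + 1) * ∏ j, (D j : ℝ)
        ≤ 2 ^ (k + 23) * K * X * s ^ k := hmain
      _ < T * X * s ^ k := by
          apply mul_lt_mul_of_pos_right _ hsk
          exact mul_lt_mul_of_pos_right hK' hX0
      _ < xf * s ^ k := mul_lt_mul_of_pos_right hxf hsk
      _ = s ^ k * xf := mul_comm _ _

/-- **Exit B, `d₀ = 0` (`G* = {e}`)**: `(n+1)!·n!·2ⁿ·D₀·∏ Dⱼ < (S₀+1)ⁿ·(2X_fin+1)`.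
[cite: Nesterenko2003, §5.2 Lemma 5.4] -/
theorem exitB_zero_of {n : ℕ} (hn : 1 ≤ n) {V : Fin n → ℝ} (hV1 : ∀ j, 1 ≤ V j)
    {D : Fin n → ℕ} {ρ L X K c T : ℝ} {S₀ Xf D₀ : ℕ}
    (hDρ : ∀ j, (D j : ℝ) ≤ ρ / V j + 1) (hρ1 : 1 ≤ ρ) (hρ : ρ < L / 2 ^ (n + 23)) (hL : 0 < L)
    (hX1 : 1 ≤ X) (hK1 : 1 ≤ K) (hc0 : 0 ≤ c) (hc : c ≤ (87 : ℝ) ^ n)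
    (h3L : (3 / 2 : ℝ) * (n + 1) * L ≤ X * (c * (∏ j, V j) * K))
    (hD₀8 : (D₀ : ℝ) ≤ 8 * X * (c * (∏ j, V j) * K)) (hD₀half : (D₀ : ℝ) ≤ X * L / 2)
    (hs : (16 : ℝ) * (n + 1) * L ≤ ((S₀ : ℝ) + 1) * ((n : ℝ) + 2) ^ 4)
    (h23 : (2 : ℝ) ^ (n + 23) ≤ T) (hxf : T * X < 2 * (Xf : ℝ) + 1) (hK : (2 : ℝ) ^ (n + 22) * K < T) :
    (n + 1)! * n ! * 2 ^ n * D₀ * ∏ j, D j < (S₀ + 1) ^ n * (2 * Xf + 1) := by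
  obtain ⟨k, hk⟩ : ∃ k, n = k + 1 := ⟨n - 1, (Nat.sub_add_cancel hn).symm⟩
  subst hk
  have hs0 : (0 : ℝ) < (S₀ : ℝ) + 1 := by positivity
  set s : ℝ := (S₀ : ℝ) + 1 with hsdef
  set xf : ℝ := 2 * (Xf : ℝ) + 1 with hxfdef
  have hs' : 16 * ((k : ℝ) + 2) * L ≤ s * ((k : ℝ) + 3) ^ 4 := by
    have := hs; push_cast at this; rw [hsdef]; nlinarith
  have hbase : 0 ≤ 16 * ((k : ℝ) + 2) * L := by positivity
  suffices hreal : (((k + 1 + 1)! : ℕ) : ℝ) * (((k + 1)! : ℕ) : ℝ) * 2 ^ (k + 1) * (D₀ : ℝ) *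
      ∏ j, (D j : ℝ) < s ^ (k + 1) * xf by
    rw [hsdef, hxfdef] at hreal
    exact_mod_cast hreal
  obtain ⟨j₀, -, hj₀⟩ := Finset.exists_max_image (univ : Finset (Fin (k + 1))) V ⟨0, mem_univ _⟩
  have hprod0 : 0 ≤ ∏ j, (D j : ℝ) := prod_nonneg fun j _ => by positivity
  have hD₀0 : (0 : ℝ) ≤ D₀ := by positivity
  by_cases hlt : ρ < V j₀
  · -- case (i): `∏ D ≤ (L/2^{k+22})^k`, `D₀ ≤ X L/2`
    have hprod := prod_D_le_of_lt_of hV1 hDρ hρ1 hρ hL hlt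
    simp only [Nat.add_sub_cancel] at hprod
    have hD₀ : (D₀ : ℝ) ≤ X * L / 2 := hD₀half
    have hnum : (((k + 2)! * (k + 1)! * 2 ^ k * (k + 3) ^ (4 * (k + 1)) : ℕ) : ℝ) ≤
        (((16 * (k + 2)) ^ (k + 1) * 2 ^ ((k + 22) * k) * 2 ^ (k + 24) : ℕ) : ℝ) := by
      exact_mod_cast numB0i k
    push_cast at hnum
    set Q : ℝ := (16 * ((k : ℝ) + 2)) ^ (k + 1) * 2 ^ ((k + 22) * k) with hQ
    have hQ0 : 0 < Q := by positivity
    -- `L (L/2^{k+22})^k Q = (16(k+2)L)^{k+1}`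
    have e1 : L * (L / 2 ^ (k + 1 + 21)) ^ k * Q = (16 * ((k : ℝ) + 2) * L) ^ (k + 1) := by
      rw [hQ, show k + 1 + 21 = k + 22 by ring]
      simp only [mul_pow, div_pow]
      rw [← pow_mul]
      field_simp
      ring
    have hpow : (16 * ((k : ℝ) + 2) * L) ^ (k + 1) ≤ (s * ((k : ℝ) + 3) ^ 4) ^ (k + 1) :=
      pow_le_pow_left₀ hbase hs' _
    have key : (((k + 1 + 1)! : ℕ) : ℝ) * (((k + 1)! : ℕ) : ℝ) * 2 ^ (k + 1) * (D₀ : ℝ) *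
          (∏ j, (D j : ℝ)) * Q ≤ (2 ^ (k + 24) * X * s ^ (k + 1)) * Q := by
      calc (((k + 1 + 1)! : ℕ) : ℝ) * (((k + 1)! : ℕ) : ℝ) * 2 ^ (k + 1) * (D₀ : ℝ) * (∏ j, (D j : ℝ)) * Q
          ≤ (((k + 1 + 1)! : ℕ) : ℝ) * (((k + 1)! : ℕ) : ℝ) * 2 ^ (k + 1) * (X * L / 2) *
              (L / 2 ^ (k + 1 + 21)) ^ k * Q := by gcongr
        _ = (((k + 1 + 1)! : ℕ) : ℝ) * (((k + 1)! : ℕ) : ℝ) * 2 ^ k * X *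
              (L * (L / 2 ^ (k + 1 + 21)) ^ k * Q) := by rw [pow_succ]; ring
        _ ≤ (((k + 1 + 1)! : ℕ) : ℝ) * (((k + 1)! : ℕ) : ℝ) * 2 ^ k * X *
              (s * ((k : ℝ) + 3) ^ 4) ^ (k + 1) := by rw [e1]; gcongr
        _ = ((((k + 2)! : ℕ) : ℝ) * (((k + 1)! : ℕ) : ℝ) * 2 ^ k * ((k : ℝ) + 3) ^ (4 * (k + 1))) *
              X * s ^ (k + 1) := by
            rw [mul_pow, ← pow_mul, show k + 1 + 1 = k + 2 by ring]; ring
        _ ≤ ((16 * ((k : ℝ) + 2)) ^ (k + 1) * 2 ^ ((k + 22) * k) * 2 ^ (k + 24)) * X * s ^ (k + 1) := by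
            gcongr
        _ = (2 ^ (k + 24) * X * s ^ (k + 1)) * Q := by rw [hQ]; ring
    have hmain := le_of_mul_le_mul_right key hQ0
    have h1 : (2 : ℝ) ^ (k + 24) ≤ T := by
      simpa [show k + 1 + 23 = k + 24 by ring] using h23
    have hsk : 0 < s ^ (k + 1) := by positivity
    have hX0 : (0 : ℝ) < X := by linarith
    calc (((k + 1 + 1)! : ℕ) : ℝ) * (((k + 1)! : ℕ) : ℝ) * 2 ^ (k + 1) * (D₀ : ℝ) * ∏ j, (D j : ℝ)
        ≤ 2 ^ (k + 24) * X * s ^ (k + 1) := hmain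
      _ ≤ T * X * s ^ (k + 1) := by gcongr
      _ < xf * s ^ (k + 1) := mul_lt_mul_of_pos_right hxf hsk
      _ = s ^ (k + 1) * xf := mul_comm _ _
  · -- case (ii): `Ω ∏ D ≤ (L/2^{k+23})^{k+1}`, `D₀ ≤ 8 X Cb^{k+1} Ω K`
    have hle : ∀ j, V j ≤ ρ := fun j =>
      (hj₀ j (mem_univ j)).trans (not_lt.mp hlt)
    have hprod := prod_mul_prod_D_le_of hV1 hDρ hρ1 hρ hL hle
    have hΩ : 0 < ∏ j, V j := prod_pos fun j _ => by linarith [hV1 j]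
    have hD₀ := hD₀8
    have hnum : (((k + 2)! * (k + 1)! * 2 ^ (k + 4) * 87 ^ (k + 1) * (k + 3) ^ (4 * (k + 1)) : ℕ) : ℝ) ≤
        (((16 * (k + 2)) ^ (k + 1) * 2 ^ ((k + 1) * (k + 23)) * 2 ^ (k + 23) : ℕ) : ℝ) := by
      exact_mod_cast numB0ii k
    push_cast at hnum
    have hCbpow : c ≤ (87 : ℝ) ^ (k + 1) := hc
    set Q : ℝ := (16 * ((k : ℝ) + 2)) ^ (k + 1) * 2 ^ ((k + 1) * (k + 23)) with hQ
    have hQ0 : 0 < Q := by positivity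
    have e1 : (L / 2 ^ (k + 1 + 22)) ^ (k + 1) * Q = (16 * ((k : ℝ) + 2) * L) ^ (k + 1) := by
      rw [hQ, show k + 1 + 22 = k + 23 by ring, mul_comm (k + 1) (k + 23)]
      simp only [mul_pow, div_pow]
      rw [← pow_mul]
      field_simp
    have hpow : (16 * ((k : ℝ) + 2) * L) ^ (k + 1) ≤ (s * ((k : ℝ) + 3) ^ 4) ^ (k + 1) :=
      pow_le_pow_left₀ hbase hs' _
    -- abbreviations
    set A : ℝ := (((k + 1 + 1)! : ℕ) : ℝ) * (((k + 1)! : ℕ) : ℝ) * 2 ^ (k + 1) with hA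
    have hA0 : 0 ≤ A := by positivity
    have hXΩK : 0 ≤ 8 * X * (c * (∏ j, V j) * K) := by
      have hΩ' : 0 < ∏ j, V j := prod_pos fun j _ => by linarith [hV1 j]
      positivity
    -- step 1: `D₀ · (Ω ∏D) ≤ 8X(Cb^{k+1} Ω K) · (L/2^{k+23})^{k+1}`
    have step1 : (D₀ : ℝ) * ((∏ j, V j) * ∏ j, (D j : ℝ)) ≤
        (8 * X * (c * (∏ j, V j) * K)) * (L / 2 ^ (k + 1 + 22)) ^ (k + 1) :=
      mul_le_mul hD₀ hprod (mul_nonneg hΩ.le hprod0) hXΩK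
    -- step 2: `(L/2^{k+23})^{k+1} · Q ≤ (s (k+3)^4)^{k+1}`
    have step2 : (L / 2 ^ (k + 1 + 22)) ^ (k + 1) * Q ≤ (s * ((k : ℝ) + 3) ^ 4) ^ (k + 1) := by
      rw [e1]; exact hpow
    -- step 3: `Cb^{k+1} ≤ 87^{k+1}` inside the constant, then the master corollary
    have step3 : (((k + 2)! : ℕ) : ℝ) * (((k + 1)! : ℕ) : ℝ) * 2 ^ (k + 4) * c *
        ((k : ℝ) + 3) ^ (4 * (k + 1)) ≤
        (16 * ((k : ℝ) + 2)) ^ (k + 1) * 2 ^ ((k + 1) * (k + 23)) * 2 ^ (k + 23) := by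
      refine le_trans ?_ hnum
      have h0 : 0 ≤ (((k + 2)! : ℕ) : ℝ) * (((k + 1)! : ℕ) : ℝ) * 2 ^ (k + 4) * ((k : ℝ) + 3) ^ (4 * (k + 1)) := by
        positivity
      calc (((k + 2)! : ℕ) : ℝ) * (((k + 1)! : ℕ) : ℝ) * 2 ^ (k + 4) * c * ((k : ℝ) + 3) ^ (4 * (k + 1))
          = (((k + 2)! : ℕ) : ℝ) * (((k + 1)! : ℕ) : ℝ) * 2 ^ (k + 4) * ((k : ℝ) + 3) ^ (4 * (k + 1)) *
              c := by ring
        _ ≤ (((k + 2)! : ℕ) : ℝ) * (((k + 1)! : ℕ) : ℝ) * 2 ^ (k + 4) * ((k : ℝ) + 3) ^ (4 * (k + 1)) *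
              87 ^ (k + 1) := mul_le_mul_of_nonneg_left hCbpow h0
        _ = (((k + 2)! : ℕ) : ℝ) * (((k + 1)! : ℕ) : ℝ) * 2 ^ (k + 4) * 87 ^ (k + 1) *
              ((k : ℝ) + 3) ^ (4 * (k + 1)) := by ring
    have hfac2 : (((k + 1 + 1)! : ℕ) : ℝ) = (((k + 2)! : ℕ) : ℝ) := by
      rw [show k + 1 + 1 = k + 2 by ring]
    have hrest0 : 0 ≤ X * (∏ j, V j) * K * s ^ (k + 1) := by positivity
    have key : A * (D₀ : ℝ) * (∏ j, (D j : ℝ)) * ((∏ j, V j) * Q) ≤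
        (2 ^ (k + 23) * K * X * s ^ (k + 1)) * ((∏ j, V j) * Q) := by
      calc A * (D₀ : ℝ) * (∏ j, (D j : ℝ)) * ((∏ j, V j) * Q)
          = A * ((D₀ : ℝ) * ((∏ j, V j) * ∏ j, (D j : ℝ))) * Q := by ring
        _ ≤ A * ((8 * X * (c * (∏ j, V j) * K)) * (L / 2 ^ (k + 1 + 22)) ^ (k + 1)) * Q :=
            mul_le_mul_of_nonneg_right (mul_le_mul_of_nonneg_left step1 hA0) hQ0.le
        _ = A * (8 * X * (c * (∏ j, V j) * K)) * ((L / 2 ^ (k + 1 + 22)) ^ (k + 1) * Q) := by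
            ring
        _ ≤ A * (8 * X * (c * (∏ j, V j) * K)) * (s * ((k : ℝ) + 3) ^ 4) ^ (k + 1) :=
            mul_le_mul_of_nonneg_left step2 (mul_nonneg hA0 hXΩK)
        _ = ((((k + 2)! : ℕ) : ℝ) * (((k + 1)! : ℕ) : ℝ) * 2 ^ (k + 4) * c *
              ((k : ℝ) + 3) ^ (4 * (k + 1))) * (X * (∏ j, V j) * K * s ^ (k + 1)) := by
            rw [hA, hfac2, mul_pow, ← pow_mul]; ring
        _ ≤ ((16 * ((k : ℝ) + 2)) ^ (k + 1) * 2 ^ ((k + 1) * (k + 23)) * 2 ^ (k + 23)) *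
              (X * (∏ j, V j) * K * s ^ (k + 1)) := mul_le_mul_of_nonneg_right step3 hrest0
        _ = (2 ^ (k + 23) * K * X * s ^ (k + 1)) * ((∏ j, V j) * Q) := by rw [hQ]; ring
    have hmain := le_of_mul_le_mul_right key (by positivity)
    have hK' : (2 : ℝ) ^ (k + 23) * K < T := by
      simpa [show k + 1 + 22 = k + 23 by ring] using hK
    have hsk : 0 < s ^ (k + 1) := by positivity
    have hX0 : (0 : ℝ) < X := by linarith
    calc A * (D₀ : ℝ) * ∏ j, (D j : ℝ)
        ≤ 2 ^ (k + 23) * K * X * s ^ (k + 1) := hmain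
      _ < T * X * s ^ (k + 1) := by
          apply mul_lt_mul_of_pos_right _ hsk
          exact mul_lt_mul_of_pos_right hK' hX0
      _ < xf * s ^ (k + 1) := mul_lt_mul_of_pos_right hxf hsk
      _ = s ^ (k + 1) * xf := mul_comm _ _

/-- **Exit B from the scalar facts**: hypothesis `hB` of `RecordAssembly.recordTwo_of_ineqs` /
`recordOdd_of_ineqs` for `(D₀, S₀, X_f, D)`. [cite: Nesterenko2003, §5.2 Lemma 5.4] -/
theorem exitB_of {n : ℕ} (hn : 1 ≤ n) {V : Fin n → ℝ} (hV1 : ∀ j, 1 ≤ V j)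
    {D : Fin n → ℕ} {ρ L X K c T : ℝ} {S₀ Xf D₀ : ℕ}
    (hDρ : ∀ j, (D j : ℝ) ≤ ρ / V j + 1) (hρ1 : 1 ≤ ρ) (hρ : ρ < L / 2 ^ (n + 23)) (hL : 0 < L)
    (hX1 : 1 ≤ X) (hK1 : 1 ≤ K) (hc0 : 0 ≤ c) (hc : c ≤ (87 : ℝ) ^ n)
    (h3L : (3 / 2 : ℝ) * (n + 1) * L ≤ X * (c * (∏ j, V j) * K))
    (hD₀8 : (D₀ : ℝ) ≤ 8 * X * (c * (∏ j, V j) * K)) (hD₀half : (D₀ : ℝ) ≤ X * L / 2)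
    (hs : (16 : ℝ) * (n + 1) * L ≤ ((S₀ : ℝ) + 1) * ((n : ℝ) + 2) ^ 4)
    (h23 : (2 : ℝ) ^ (n + 23) ≤ T) (hxf : T * X < 2 * (Xf : ℝ) + 1) (hK : (2 : ℝ) ^ (n + 22) * K < T) (hD₀1 : 1 ≤ D₀) : ∀ d₀ : ℕ, d₀ ≤ 1 →
    (n + 1)! * 2 ^ n * D₀ * ∏ j, D j <
      Nat.choose (S₀ + (n - d₀)) (n - d₀) * (2 * Xf + 1) * (d₀ ! * D₀ ^ d₀) := by
  have hB1 := exitB_one_of hn hV1 hDρ hρ1 hρ hL hX1 hK1 hc0 hc h3L hD₀8 hD₀half hs h23 hxf hK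
  have hB0 := exitB_zero_of hn hV1 hDρ hρ1 hρ hL hX1 hK1 hc0 hc h3L hD₀8 hD₀half hs h23 hxf hK
  exact exitB_of_bounds hD₀1 le_rfl hB0 hB1

end RecordExitsNumeric

end Summit.ABC.StewartYu

end
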